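import Summits.SmoothPoincare4.SmoothPoincare4.Theorems.SymplecticOrigamiOrigamiFoldExistenceShadowPleatsDefs
import Summits.SmoothPoincare4.SmoothPoincare4.Statement
import Literature.Topology.FourManifolds.CerfGammaFourProofs
import Literature.Topology.FourManifolds.ClosedBallProofs
import Mathlib.Geometry.Manifold.LocalDiffeomorph

/-!
# Line `shadow-pleats` for crux `OrigamiFoldExistence`: transport of pleated positions along
diffeomorphisms, and the zero-slack certificate of stub `stub_pleatCollapse`
(item stmt-SmoothPoincare4-7844, route route-SmoothPoincare4-SymplecticOrigami)

The vocabulary is the line's Defs file (`…ShadowPleatsDefs.lean`, p96059):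
`IsPleatedPosition ι δ e`, `HasPleatedPosition M k`.

* `IsPleatedPosition.comp_diffeomorph` / `hasPleatedPosition_of_diffeomorph` (registered sub-goal
  `hasPleatedPosition_of_diffeomorph` of the crux): a pleated round-rim shadow position of `N` in
  `ℝ⁵` with `k` pleats pulls back along a `C^∞` diffeomorphism `Φ : M ≅ N` to one of `M` with `k`
  pleats — `ι ↦ ι ∘ Φ`, `e j ↦ Φ⁻¹ ∘ e j`, same `δ`.  The round part, the heights and the fold
  clause are literally unchanged (`range (ι ∘ Φ) = range ι`,
  `proj5 ∘ (ι ∘ Φ) ∘ (Φ⁻¹ ∘ e j) = proj5 ∘ ι ∘ e j`); the embedding clauses are the tree's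
  `Manifold.IsSmoothEmbedding.comp_diffeomorph` / `.diffeomorph_comp` (pre/post-composition with a
  diffeomorphism, `CerfGammaFourProofs.lean` / `ClosedBallProofs.lean`); the immersivity clause is
  the chain rule with the invertible differential `Diffeomorph.mfderivToContinuousLinearEquiv`.
* `stub_pleatCollapse_of_smoothPoincare4` — the line's ZERO-SLACK CERTIFICATE as kernel lines:
  the smooth 4-dimensional Poincaré conjecture (`SmoothPoincare4`, the summit statement) implies
  the registered stub `stub_pleatCollapse` VERBATIM (indeed with `k' = 0`): a homotopy 4-sphere is
  then diffeomorphic to Mathlib's round `S⁴`, which is in pleat-free position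
  (`hasPleatedPosition_sphere_zero`, Defs file), and pleat-free positions transport.  Conversely,
  given the line's stubs S4–S6 (`stub_twoPleatUnthreading`, `stub_onePleatIroning`,
  `stub_pleatFreeStandard`) and S1–S2, `stub_pleatCollapse` implies `SmoothPoincare4`; so the stub
  is exactly SPC4-hard — the named zero-slack carrier of the line (crux-level statement:
  `Negative.ZeroSlackSharp`).

Deliberately NOT here: any claim towards `stub_pleatCollapse` itself (open problem), and the other
stubs of the line.
-/

noncomputable section

-- the prescribed namespace `Summit.<P>.<Sub>.…` duplicates `SmoothPoincare4` (P = Sub)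
set_option linter.dupNamespace false

open scoped Manifold ContDiff Topology
open Set Function ContinuousMap

namespace Summit.SmoothPoincare4.SmoothPoincare4.Theorems.OrigamiFoldExistence.ShadowPleats

/-- **Pull-back of a pleated position along a diffeomorphism.** If `(ι, δ, e)` is a pleated
round-rim shadow position of `N` with `k` pleat charts and `Φ : M ≅ N` is a `C^∞` diffeomorphism,
then `(ι ∘ Φ, δ, Φ⁻¹ ∘ e ·)` is a pleated round-rim shadow position of `M` with `k` pleat charts:
the image hypersurface `ι(N) = (ι ∘ Φ)(M) ⊂ ℝ⁵`, its shadow and its fold spheres are the same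
subsets, only the parametrising manifold changes. [folklore] -/
theorem IsPleatedPosition.comp_diffeomorph {M N : Type} [TopologicalSpace M]
    [ChartedSpace (EuclideanSpace ℝ (Fin 4)) M] [IsManifold (𝓡 4) ∞ M] [TopologicalSpace N]
    [ChartedSpace (EuclideanSpace ℝ (Fin 4)) N] [IsManifold (𝓡 4) ∞ N] (Φ : M ≃ₘ⟮𝓡 4, 𝓡 4⟯ N)
    {ι : N → EuclideanSpace ℝ (Fin 5)} {δ : ℝ} {k : ℕ} {e : Fin k → EuclideanSpace ℝ (Fin 4) → N}
    (h : IsPleatedPosition ι δ e) : IsPleatedPosition (ι ∘ Φ) δ (fun j => Φ.symm ∘ e j) := by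
  obtain ⟨hι, hδ0, hδ1, hround, hcharts, hdisj, hinj, hfold⟩ := h
  have hn : (∞ : WithTop ℕ∞) ≠ 0 := by simp
  refine ⟨hι.comp_diffeomorph Φ, hδ0, hδ1, ?_, ?_, ?_, ?_, ?_⟩
  · -- ROUND PART: `range (ι ∘ Φ) = range ι`
    rw [(EquivLike.surjective Φ).range_comp]
    exact hround
  · -- PLEAT CHARTS: `Φ⁻¹ ∘ e j` is a smooth embedding, at the same heights
    intro j
    refine ⟨(hcharts j).1.diffeomorph_comp Φ.symm, fun u => ?_⟩
    simp only [Function.comp_apply, Diffeomorph.apply_symm_apply]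
    exact (hcharts j).2 u
  · -- the fold spheres stay pairwise disjoint (`Φ⁻¹` is injective)
    intro i j hij
    have hd := hdisj hij
    simp only [Function.onFun] at hd ⊢
    rw [Set.image_comp, Set.image_comp, Set.disjoint_image_iff (EquivLike.injective Φ.symm)]
    exact hd
  · -- SHADOW immersive above the plane off the fold spheres: chain rule
    intro m hm hnot
    have hm' : 1 - δ < ι (Φ m) 4 := hm
    have hnot' : Φ m ∉ ⋃ j, e j '' pleatSpheres := by
      intro hmem
      apply hnot
      simp only [Set.mem_iUnion, Set.mem_image, Function.comp_apply] at hmem ⊢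
      obtain ⟨j, u, hu, hju⟩ := hmem
      exact ⟨j, u, hu, by rw [hju, Diffeomorph.symm_apply_apply]⟩
    have h1 : MDifferentiableAt (𝓡 4) 𝓘(ℝ, EuclideanSpace ℝ (Fin 5)) ι (Φ m) :=
      (hι.contMDiff (Φ m)).mdifferentiableAt hn
    have h2 : MDifferentiableAt 𝓘(ℝ, EuclideanSpace ℝ (Fin 5)) 𝓘(ℝ, EuclideanSpace ℝ (Fin 4))
        proj5 (ι (Φ m)) := by
      rw [← coe_proj5L]
      exact proj5L.hasMFDerivAt.mdifferentiableAt
    have hdiff : MDifferentiableAt (𝓡 4) (𝓡 4) (proj5 ∘ ι) (Φ m) := h2.comp (Φ m) h1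
    have hcomp : mfderiv (𝓡 4) (𝓡 4) (proj5 ∘ ι ∘ Φ) m =
        (mfderiv (𝓡 4) (𝓡 4) (proj5 ∘ ι) (Φ m)).comp (mfderiv (𝓡 4) (𝓡 4) Φ m) :=
      mfderiv_comp m hdiff (Φ.mdifferentiable hn m)
    rw [hcomp]
    exact (hinj (Φ m) hm' hnot').comp (Φ.mfderivToContinuousLinearEquiv hn m).injective
  · -- FOLD at every fold-sphere point: the chart representative is literally the same map
    intro j u hu
    have heq : proj5 ∘ (ι ∘ Φ) ∘ (Φ.symm ∘ e j) = proj5 ∘ ι ∘ e j := by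
      funext w
      simp only [Function.comp_apply, Diffeomorph.apply_symm_apply]
    rw [heq]
    exact hfold j u hu

/-- **Transport of pleated positions along diffeomorphisms** (registered sub-goal
`hasPleatedPosition_of_diffeomorph` of crux stmt-SmoothPoincare4-7844, line `shadow-pleats`): if
`Φ : M ≅ N` is a `C^∞` diffeomorphism and `N` admits a pleated round-rim shadow position with `k`
pleat charts, then so does `M` (pull back `ι ↦ ι ∘ Φ`, `e j ↦ Φ⁻¹ ∘ e j`). [folklore] -/
theorem hasPleatedPosition_of_diffeomorph :
    ∀ (M N : Type) [TopologicalSpace M] [T2Space M] [SecondCountableTopology M]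
      [ChartedSpace (EuclideanSpace ℝ (Fin 4)) M] [IsManifold (𝓡 4) ∞ M]
      [TopologicalSpace N] [T2Space N] [SecondCountableTopology N]
      [ChartedSpace (EuclideanSpace ℝ (Fin 4)) N] [IsManifold (𝓡 4) ∞ N]
      (Φ : M ≃ₘ⟮𝓡 4, 𝓡 4⟯ N) (k : ℕ), HasPleatedPosition N k → HasPleatedPosition M k := by
  intro M N _ _ _ _ _ _ _ _ _ _ Φ k h
  obtain ⟨ι, δ, e, h⟩ := h
  exact ⟨ι ∘ Φ, δ, fun j => Φ.symm ∘ e j, h.comp_diffeomorph Φ⟩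

/-- **A 4-manifold diffeomorphic to the round sphere has a pleat-free position**: the `M`-wise
form of the zero-slack certificate — `Nonempty (M ≃ₘ S⁴)` gives a pleated round-rim shadow
position of `M` with `0 ≤ 2` pleat charts, by transport of `hasPleatedPosition_sphere_zero` (the
round sphere itself, `δ = 1/2`, Defs file) along the diffeomorphism. [folklore] -/
theorem pleatCollapse_of_nonempty_diffeomorph {M : Type} [TopologicalSpace M] [T2Space M]
    [SecondCountableTopology M] [ChartedSpace (EuclideanSpace ℝ (Fin 4)) M] [IsManifold (𝓡 4) ∞ M]
    (h : Nonempty (M ≃ₘ⟮𝓡 4, 𝓡 4⟯ (Metric.sphere (0 : EuclideanSpace ℝ (Fin 5)) 1))) :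
    ∃ k', k' ≤ 2 ∧ HasPleatedPosition M k' := by
  obtain ⟨Φ⟩ := h
  exact ⟨0, Nat.zero_le 2, hasPleatedPosition_of_diffeomorph M _ Φ 0 hasPleatedPosition_sphere_zero⟩

/-- **Zero-slack certificate of `stub_pleatCollapse` (kernel form).** The smooth 4-dimensional
Poincaré conjecture `SmoothPoincare4` implies the registered stub `stub_pleatCollapse` of line
`shadow-pleats` verbatim (with `k' = 0`, ignoring the given `k`-pleat position): a homotopy
4-sphere is then diffeomorphic to the round `S⁴ ⊂ ℝ⁵`, which is in pleat-free position
(`hasPleatedPosition_sphere_zero`), and pleated positions transport along diffeomorphisms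
(`hasPleatedPosition_of_diffeomorph`).  Together with the converse through the line's stubs S4–S6
this exhibits `stub_pleatCollapse` as the line's zero-slack carrier. [folklore] -/
theorem stub_pleatCollapse_of_smoothPoincare4 (hS : _root_.SmoothPoincare4) :
    ∀ (M : Type) [TopologicalSpace M] [T2Space M] [SecondCountableTopology M]
      [ChartedSpace (EuclideanSpace ℝ (Fin 4)) M] [IsManifold (𝓡 4) ∞ M],
      M ≃ₕ (Metric.sphere (0 : EuclideanSpace ℝ (Fin 5)) 1) →
      ∀ k, HasPleatedPosition M k → ∃ k', k' ≤ 2 ∧ HasPleatedPosition M k' := by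
  intro M _ _ _ _ _ hM k _
  have hS' := hS
  unfold _root_.SmoothPoincare4 Literature.SPC4.SmoothPoincareConjectureFour
    ContinuousMap.HomotopyEquiv.NonemptyDiffeomorphSphere at hS'
  exact pleatCollapse_of_nonempty_diffeomorph (hS' M inferInstance inferInstance hM)

end Summit.SmoothPoincare4.SmoothPoincare4.Theorems.OrigamiFoldExistence.ShadowPleats

end
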